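import Literature.Topology.FourManifolds.WrinkledFibrationMoveModels
import Literature.Topology.FourManifolds.IndefiniteCuspModel
import HarnessLib

/-!
# Critical images of suspended families: folds versus cusps along a critical curve

Topic `Literature/Topology/FourManifolds`.  For a suspended family
`F(t, x, y, z) = (t, g(t, x) + y² - z²)` (`WrinkledFibrationMoveModels.lean`) whose critical
set `{∂ₓ g = 0, y = z = 0}` is the graph `t = τ(x)` of a function over the `x`-axis — the cusp
model (`τ(u) = -3u²`) and Lekili's flipping family (`τ(u) = 2 s u - 4 u³`) — the CRITICAL IMAGE
is the plane curve `u ↦ F(τ(u), u, 0, 0) = (τ(u), g(τ(u), u))`, and its velocity is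
`τ'(u) · (1, ∂ₜ g)` (the `∂ₓ g` term drops out on the critical set).  So the critical image is
immersed exactly where `τ' ≠ 0` (fold arcs of the base diagram) and has its singular points —
the cusps of the base diagram — where `τ' = 0`.  Read on the models: the cusp model has exactly
one such point, `u = 0`; the flipping family has none for `s < 0`, the single degenerate point
`u = 0` at `s = 0`, and exactly the two points `u = ±√(s/6)` for `s > 0` — Lekili 2009, §3,
Move 3: *"for `s<0`, the critical value set consists of a simple curve … For `s>0`, we get a
wrinkled map with critical value set, including two cusp singularities"* (the flip of
Baykur–Saeki 2017, §3.1, Fig. 4, an always-realizable move).  Everything is PROVED at the level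
of the model maps (no statement about charts of an abstract map is made); no named fact.

* `suspendedCurve τ`, `suspendedMap_suspendedCurve`, `hasDerivAt_suspendedImage` — the
  velocity formula `τ'(u) • (1, ∂ₜ g)` and `suspendedImage_deriv_eq_zero_iff` (`= 0 ↔ τ' = 0`);
* `hasDerivAt_indefiniteCusp_image`, `indefiniteCusp_image_deriv_eq_zero_iff` (`↔ u = 0`);
* `hasDerivAt_flip_image`, `flip_image_deriv_eq_zero_iff` (`↔ 6u² = s`),
  `flip_image_deriv_ne_zero_of_neg` (`s < 0`: immersed critical image, no cusp),
  `flip_image_deriv_eq_zero_iff_of_pos` (`s > 0`: exactly `u = ±√(s/6)`).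

## References

* Y. Lekili, *Wrinkled fibrations on near-symplectic manifolds*, Geom. Topol. 13 (2009)
  277–318 (arXiv:0712.2202), §3, Move 3. [Lekili2009]
* R. İ. Baykur, O. Saeki, *Simplifying indefinite fibrations on 4-manifolds*, arXiv:1705.11169,
  §2.1 (base diagrams), §3.1. [BaykurSaeki2017]
-/

noncomputable section

open scoped ContDiff
open Set Function

namespace Literature.Topology.FourManifolds

/-- Local notation: `𝔼 n` is the model Euclidean space `EuclideanSpace ℝ (Fin n)`. -/
local notation "𝔼 " n:arg => EuclideanSpace ℝ (Fin n)

/-! ### Graph-type critical curves and the velocity of the critical image -/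

/-- The curve `u ↦ (τ(u), u, 0, 0)` in `ℝ⁴`: the shape of the critical set of a suspended
family when `{∂ₓ g = 0}` is a graph `t = τ(x)` over the `x`-axis. [folklore] -/
def suspendedCurve (τ : ℝ → ℝ) (u : ℝ) : 𝔼 4 :=
  WithLp.toLp 2 ![τ u, u, 0, 0]

/-- Coordinates of `suspendedCurve`. [folklore] -/
@[simp] theorem suspendedCurve_apply_zero (τ : ℝ → ℝ) (u : ℝ) : suspendedCurve τ u 0 = τ u := by
  simp [suspendedCurve]

/-- Coordinates of `suspendedCurve`. [folklore] -/
@[simp] theorem suspendedCurve_apply_one (τ : ℝ → ℝ) (u : ℝ) : suspendedCurve τ u 1 = u := by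
  simp [suspendedCurve]

/-- Coordinates of `suspendedCurve`. [folklore] -/
@[simp] theorem suspendedCurve_apply_two (τ : ℝ → ℝ) (u : ℝ) : suspendedCurve τ u 2 = 0 := by
  simp [suspendedCurve]

/-- Coordinates of `suspendedCurve`. [folklore] -/
@[simp] theorem suspendedCurve_apply_three (τ : ℝ → ℝ) (u : ℝ) : suspendedCurve τ u 3 = 0 := by
  simp [suspendedCurve]

/-- **The critical image as a plane curve**: `F(τ(u), u, 0, 0) = (τ(u), g(τ(u), u))`, written
in the basis `e₀, e₁` of `ℝ²`. [folklore] -/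
theorem suspendedMap_suspendedCurve (g : ℝ × ℝ → ℝ) (τ : ℝ → ℝ) (u : ℝ) :
    suspendedMap g (suspendedCurve τ u) =
      (τ u) • EuclideanSpace.single (0 : Fin 2) (1 : ℝ) +
        (g (τ u, u)) • EuclideanSpace.single (1 : Fin 2) (1 : ℝ) := by
  ext i
  fin_cases i <;> simp

/-- **Velocity of the critical image.**  If `τ` has derivative `τ'` at `u`, `g` has
derivative `g'` at `(τ u, u)` and `(τ u, u)` is critical (`∂ₓ g = g'(0,1) = 0`), then the image
curve `u ↦ F(τ(u), u, 0, 0)` has velocity `τ' • (1, ∂ₜ g)` at `u`: by the chain rule the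
second component moves at `τ' ∂ₜ g + ∂ₓ g = τ' ∂ₜ g`. [folklore] -/
theorem hasDerivAt_suspendedImage {g : ℝ × ℝ → ℝ} {g' : ℝ × ℝ →L[ℝ] ℝ} {τ : ℝ → ℝ} {τ' u : ℝ}
    (hτ : HasDerivAt τ τ' u) (hg : HasFDerivAt g g' (τ u, u)) (hcrit : g' (0, 1) = 0) :
    HasDerivAt (fun u => suspendedMap g (suspendedCurve τ u))
      (τ' • (EuclideanSpace.single (0 : Fin 2) (1 : ℝ) +
        (g' (1, 0)) • EuclideanSpace.single (1 : Fin 2) (1 : ℝ))) u := by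
  have hP : HasDerivAt (fun x : ℝ => (τ x, x)) (τ', (1 : ℝ)) u := hτ.prodMk (hasDerivAt_id' u)
  have h2 : HasDerivAt (g ∘ fun x : ℝ => (τ x, x)) (g' (τ', 1)) u :=
    HasFDerivAt.comp_hasDerivAt (f := fun x : ℝ => (τ x, x)) u hg hP
  have key : g' (τ', 1) = τ' * g' (1, 0) := by
    rw [OneParamTransversality.apply_prod_eq g' τ' 1, hcrit]
    ring
  have h := (hτ.smul_const (EuclideanSpace.single (0 : Fin 2) (1 : ℝ))).add
    ((h2.congr_deriv key).smul_const (EuclideanSpace.single (1 : Fin 2) (1 : ℝ)))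
  have hval : τ' • EuclideanSpace.single (0 : Fin 2) (1 : ℝ) +
      (τ' * g' (1, 0)) • EuclideanSpace.single (1 : Fin 2) (1 : ℝ) =
        τ' • (EuclideanSpace.single (0 : Fin 2) (1 : ℝ) +
          (g' (1, 0)) • EuclideanSpace.single (1 : Fin 2) (1 : ℝ)) := by
    rw [smul_add, smul_smul]
  have hfun : (fun u => suspendedMap g (suspendedCurve τ u)) = fun u =>
      (τ u) • EuclideanSpace.single (0 : Fin 2) (1 : ℝ) +
        (g (τ u, u)) • EuclideanSpace.single (1 : Fin 2) (1 : ℝ) :=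
    funext (suspendedMap_suspendedCurve g τ)
  rw [hfun]
  exact h.congr_deriv hval

/-- **The critical image is immersed exactly where `τ' ≠ 0`**: the velocity
`τ' • (1, ∂ₜ g)` vanishes iff `τ' = 0` (its first component is `τ'`). [folklore] -/
theorem suspendedImage_deriv_eq_zero_iff (τ' a : ℝ) :
    τ' • (EuclideanSpace.single (0 : Fin 2) (1 : ℝ) + a • EuclideanSpace.single (1 : Fin 2) (1 : ℝ))
        = 0 ↔ τ' = 0 := by
  refine ⟨fun h => ?_, fun h => by simp [h]⟩
  simpa using congrArg (fun w : 𝔼 2 => w 0) h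

/-! ### The cusp model: one non-immersed point, the cusp -/

/-- The critical curve of the cusp model is the graph of `τ(u) = -3u²`. [folklore] -/
theorem indefiniteCuspCurve_eq_suspendedCurve :
    indefiniteCuspCurve = suspendedCurve fun u => -(3 * u ^ 2) := rfl

/-- **Velocity of the critical image of the cusp model** (`(-3u², -2u³)`): `(-6u) • (1, u)`.
[folklore] -/
theorem hasDerivAt_indefiniteCusp_image (u : ℝ) :
    HasDerivAt (fun u => indefiniteCuspMap (indefiniteCuspCurve u))
      ((-(6 * u)) • (EuclideanSpace.single (0 : Fin 2) (1 : ℝ) +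
        u • EuclideanSpace.single (1 : Fin 2) (1 : ℝ))) u := by
  have hτ : HasDerivAt (fun u : ℝ => -(3 * u ^ 2)) (-(6 * u)) u := by
    have h1 : HasDerivAt (fun u : ℝ => u ^ 2) (2 * u) u := by simpa using hasDerivAt_pow 2 u
    exact (h1.const_mul 3).neg.congr_deriv (by ring)
  obtain ⟨g', hg, h01, h10⟩ : ∃ g' : ℝ × ℝ →L[ℝ] ℝ,
      HasFDerivAt (fun p : ℝ × ℝ => p.2 ^ 3 + p.1 * p.2) g' (-(3 * u ^ 2), u) ∧
        g' (0, 1) = 0 ∧ g' (1, 0) = u :=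
    ⟨_, (hasFDerivAt_snd.pow 3).add (hasFDerivAt_fst.mul hasFDerivAt_snd), by simp, by simp⟩
  have h := hasDerivAt_suspendedImage (g := fun p : ℝ × ℝ => p.2 ^ 3 + p.1 * p.2) hτ hg h01
  rw [h10] at h
  exact h

/-- **The cusp is the unique singular point of the critical image of the cusp model**: the
velocity of `u ↦ (-3u², -2u³)` vanishes iff `u = 0`. [folklore] -/
theorem indefiniteCusp_image_deriv_eq_zero_iff (u : ℝ) :
    deriv (fun u => indefiniteCuspMap (indefiniteCuspCurve u)) u = 0 ↔ u = 0 := by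
  rw [(hasDerivAt_indefiniteCusp_image u).deriv, suspendedImage_deriv_eq_zero_iff]
  constructor <;> intro h <;> linarith

/-! ### The flipping family: no cusp before the flip, two after -/

/-- The critical curve of the flipping family is the graph of `τ(u) = 2 s u - 4 u³`.
[folklore] -/
theorem flipCurve_eq_suspendedCurve (s : ℝ) :
    flipCurve s = suspendedCurve fun u => 2 * s * u - 4 * u ^ 3 := by
  funext u
  ext i
  fin_cases i <;> simp [flipCurve]

/-- **Velocity of the critical image of the flipping family**: `(2s - 12u²) • (1, u)`.
[cite: Lekili2009, §3 Move 3] -/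
theorem hasDerivAt_flip_image (s u : ℝ) :
    HasDerivAt (fun u => flipMap s (flipCurve s u))
      ((2 * s - 12 * u ^ 2) • (EuclideanSpace.single (0 : Fin 2) (1 : ℝ) +
        u • EuclideanSpace.single (1 : Fin 2) (1 : ℝ))) u := by
  have hτ : HasDerivAt (fun u : ℝ => 2 * s * u - 4 * u ^ 3) (2 * s - 12 * u ^ 2) u := by
    have h1 : HasDerivAt (fun u : ℝ => u ^ 3) (3 * u ^ 2) u := by simpa using hasDerivAt_pow 3 u
    exact (((hasDerivAt_id' u).const_mul (2 * s)).sub (h1.const_mul 4)).congr_deriv (by ring)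
  obtain ⟨g', hg, h01, h10⟩ : ∃ g' : ℝ × ℝ →L[ℝ] ℝ,
      HasFDerivAt (fun p : ℝ × ℝ => p.2 ^ 4 - s * p.2 ^ 2 + p.1 * p.2) g'
          (2 * s * u - 4 * u ^ 3, u) ∧
        g' (0, 1) = 0 ∧ g' (1, 0) = u :=
    ⟨_, ((hasFDerivAt_snd.pow 4).sub ((hasFDerivAt_snd.pow 2).const_mul s)).add
      (hasFDerivAt_fst.mul hasFDerivAt_snd), by simp; ring, by simp⟩
  have h := hasDerivAt_suspendedImage (g := fun p : ℝ × ℝ => p.2 ^ 4 - s * p.2 ^ 2 + p.1 * p.2)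
    hτ hg h01
  rw [h10] at h
  rw [flipCurve_eq_suspendedCurve]
  exact h

/-- **Singular points of the critical image of the flipping family**: the velocity vanishes
iff `6u² = s`. [cite: Lekili2009, §3 Move 3] -/
theorem flip_image_deriv_eq_zero_iff (s u : ℝ) :
    deriv (fun u => flipMap s (flipCurve s u)) u = 0 ↔ 6 * u ^ 2 = s := by
  rw [(hasDerivAt_flip_image s u).deriv, suspendedImage_deriv_eq_zero_iff]
  constructor <;> intro h <;> linarith

/-- **Before the flip (`s < 0`) the critical image is immersed**: no cusp (*"for `s<0`, the
critical value set consists of a simple curve"*). [cite: Lekili2009, §3 Move 3] -/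
theorem flip_image_deriv_ne_zero_of_neg {s : ℝ} (hs : s < 0) (u : ℝ) :
    deriv (fun u => flipMap s (flipCurve s u)) u ≠ 0 := by
  rw [Ne, flip_image_deriv_eq_zero_iff]
  nlinarith [sq_nonneg u]

/-- At the flip parameter `s = 0` the critical image has a single (degenerate) singular point,
`u = 0`. [folklore] -/
theorem flip_image_deriv_eq_zero_iff_of_zero (u : ℝ) :
    deriv (fun u => flipMap 0 (flipCurve 0 u)) u = 0 ↔ u = 0 := by
  rw [flip_image_deriv_eq_zero_iff]
  constructor
  · intro h
    nlinarith [sq_nonneg u]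
  · rintro rfl
    simp

/-- **After the flip (`s > 0`) the critical image has exactly two singular points**,
`u = √(s/6)` and `u = -√(s/6)` — the *"two cusp singularities"* of the flipped base diagram.
[cite: Lekili2009, §3 Move 3] -/
theorem flip_image_deriv_eq_zero_iff_of_pos {s : ℝ} (hs : 0 < s) (u : ℝ) :
    deriv (fun u => flipMap s (flipCurve s u)) u = 0 ↔
      u = Real.sqrt (s / 6) ∨ u = -Real.sqrt (s / 6) := by
  rw [flip_image_deriv_eq_zero_iff]
  have h6 : (0 : ℝ) ≤ s / 6 := by positivity
  constructor
  · intro h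
    have hu : u ^ 2 = Real.sqrt (s / 6) ^ 2 := by
      rw [Real.sq_sqrt h6]
      linarith
    exact sq_eq_sq_iff_eq_or_eq_neg.mp hu
  · rintro (rfl | rfl)
    · rw [Real.sq_sqrt h6]
      ring
    · rw [neg_sq, Real.sq_sqrt h6]
      ring

/-- The two singular points after the flip are distinct. [folklore] -/
theorem sqrt_div_six_ne_neg {s : ℝ} (hs : 0 < s) : Real.sqrt (s / 6) ≠ -Real.sqrt (s / 6) := by
  have h : 0 < Real.sqrt (s / 6) := Real.sqrt_pos.mpr (by positivity)
  linarith

end Literature.Topology.FourManifolds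

end
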